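import Summits.QuantumFields.QCD.Theorems.QuarksAsStableActionStableActionBridgeWilsonTransferForm
import Literature.MathematicalPhysics.QuantumLattice.WilsonDiracAP

/-!
# Positivity of the Fock trace factor of the FREE antiperiodic Wilson determinant
(helper for crux stmt-QuantumFields-9737 `QuarksAsStableAction.StableActionBridge`, line `Sketch`;
stub `apTrace_free_pos`)

Lüscher's transfer-matrix form of the antiperiodic Wilson fermion determinant
(`apDet_transfer_form`, built on `wilson_det_transfer_form`, p120730) reads
`apDet U m = (∏_t det E_t) · det (1 + ∏_{i<L} M_i Ŵ_i)` with Hermitian positive definite one-step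
matrices `M_i` (of the lifted field `apLift U`) and the untwisted temporal transporters
`Ŵ_i = U((i,·),0) ⊗ 1_spin`.  For the FREE field `U = 1` the transporters are trivial (`Ŵ_i = 1`)
and the spatial links of `apLift 1` on the slice `t` do not depend on `t` (the antiperiodic lift only
looks at the coordinate of a link in its own direction, `coe_apLift_apply`), so all one-step matrices
coincide, `M_i = M_0`, and the trace factor is `det (1 + M_0 ^ L)`.  Since `M_0` is positive
definite, so is `1 + M_0 ^ L` (`Matrix.PosSemidef.pow`, `Matrix.PosDef.add_posSemidef`), whence
`det (1 + M_0 ^ L) > 0` (`Matrix.PosDef.det_pos`): a positive real number.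
[cite: Luscher1977, pp. 283–292] [cite: MontvayMunster1994, §4.2.4 (4.112)–(4.114)]
Pure theorem file (no definitions).
-/

noncomputable section

namespace Summit.QuantumFields.QCD.Cruxes.StableActionBridge.Sketch

open scoped ComplexOrder Kronecker
open Literature.MathematicalPhysics.QuantumFieldTheory Literature.MathematicalPhysics.QuantumLattice
open Literature.Probability.LatticeModels (TorusSite)

namespace APTraceFreePos

/-- An ordered product of `L` copies of `X` is `X ^ L`. -/
theorem prod_map_range_const {R : Type*} [Monoid R] (L : ℕ) (X : R) :
    ((List.range L).map fun _ : ℕ => X).prod = X ^ L := by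
  rw [List.map_const', List.length_range, List.prod_replicate]

/-- For a positive definite complex matrix `X`, `det (1 + X ^ L)` is a positive real number. -/
theorem det_one_add_pow_pos {n : Type*} [Fintype n] [DecidableEq n] {X : Matrix n n ℂ}
    (hX : X.PosDef) (L : ℕ) :
    0 < ((1 + X ^ L).det).re ∧ ((1 + X ^ L).det).im = 0 := by
  have hpos : (1 + X ^ L).PosDef := Matrix.PosDef.one.add_posSemidef (hX.posSemidef.pow L)
  have hdet := hpos.det_pos
  rw [Complex.pos_iff] at hdet
  exact ⟨hdet.1, hdet.2.symm⟩

/-- The spatial links of the antiperiodic lift of the FREE field on the slice `t` do not depend on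
`t`: `apLift 1 ((t, y), j+1)` only looks at the coordinate `y j`. -/
theorem apLift_one_cons_succ {N L : ℕ} (t : ZMod L) (y : TorusSite 3 L) (j : Fin 3) :
    apLift (1 : GaugeConfig 4 L (Matrix.specialUnitaryGroup (Fin N) ℂ))
        ((Fin.cons t y : TorusSite 4 L), j.succ) =
      apLift (1 : GaugeConfig 4 L (Matrix.specialUnitaryGroup (Fin N) ℂ))
        ((Fin.cons 0 y : TorusSite 4 L), j.succ) := by
  simp only [apLift_apply, unitaryLift_apply, Fin.cons_succ, Pi.one_apply]

end APTraceFreePos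

/-- **Positivity of the Fock trace factor of the free antiperiodic Wilson determinant** (stub
`apTrace_free_pos` of line `Sketch`): for the free field `U = 1` on `(ℤ/L)⁴` and `m > −1`, the
second factor `det (1 + ∏_{i<L} M_i Ŵ_i)` of the transfer-matrix form `apDet_transfer_form` is a
positive real number: the transporters `Ŵ_i` are `1`, all one-step matrices `M_i` coincide with the
positive definite `M_0` (`wilson_det_transfer_form`), and `det (1 + M_0 ^ L) > 0`.
[cite: Luscher1977, pp. 283–292] [cite: MontvayMunster1994, §4.2.4 (4.112)–(4.114)] -/
theorem apTrace_free_pos :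
    ∀ (N L : ℕ) [NeZero L] (m : ℝ), -1 < m →
      let Pp : Matrix (TorusSite 3 L × Fin N × Fin 4) (TorusSite 3 L × Fin N × Fin 4) ℂ := Matrix.of fun a b =>
        if a.1 = b.1 ∧ a.2.1 = b.2.1 then ((1 / 2 : ℂ) • (1 + euclideanGamma 0)) a.2.2 b.2.2 else 0;
      let Pm : Matrix (TorusSite 3 L × Fin N × Fin 4) (TorusSite 3 L × Fin N × Fin 4) ℂ := Matrix.of fun a b =>
        if a.1 = b.1 ∧ a.2.1 = b.2.1 then ((1 / 2 : ℂ) • (1 - euclideanGamma 0)) a.2.2 b.2.2 else 0;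
      let A : ZMod L → Matrix (TorusSite 3 L × Fin N × Fin 4) (TorusSite 3 L × Fin N × Fin 4) ℂ := fun t =>
        Matrix.of fun a b =>
          (if a = b then ((m + 4 * 1 : ℝ) : ℂ) else 0) -
            (1 / 2 : ℂ) * ∑ j : Fin 3,
              ((if b.1 = Literature.MathematicalPhysics.QuantumFieldTheory.Site.shift a.1 j then
                  (((1 : ℝ) : ℂ) • (1 : Matrix (Fin 4) (Fin 4) ℂ) - euclideanGamma j.succ) a.2.2 b.2.2 *
                    unitaryFundamentalRep (Fin N) ℂ
                      (apLift (1 : GaugeConfig 4 L (Matrix.specialUnitaryGroup (Fin N) ℂ))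
                        ((Fin.cons t a.1 : TorusSite 4 L), j.succ)) a.2.1 b.2.1
                else 0) +
                (if a.1 = Literature.MathematicalPhysics.QuantumFieldTheory.Site.shift b.1 j then
                  (((1 : ℝ) : ℂ) • (1 : Matrix (Fin 4) (Fin 4) ℂ) + euclideanGamma j.succ) a.2.2 b.2.2 *
                    unitaryFundamentalRep (Fin N) ℂ
                      (apLift (1 : GaugeConfig 4 L (Matrix.specialUnitaryGroup (Fin N) ℂ))
                        ((Fin.cons t b.1 : TorusSite 4 L), j.succ))⁻¹ a.2.1 b.2.1
                else 0));
      let B : ZMod L → Matrix (TorusSite 3 L × Fin N) (TorusSite 3 L × Fin N) ℂ := fun t => Matrix.of fun a b =>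
          (if a = b then ((m + 4 : ℝ) : ℂ) else 0) -
            (1 / 2 : ℂ) * ∑ j : Fin 3,
              ((if b.1 = Literature.MathematicalPhysics.QuantumFieldTheory.Site.shift a.1 j then
                  unitaryFundamentalRep (Fin N) ℂ
                    (apLift (1 : GaugeConfig 4 L (Matrix.specialUnitaryGroup (Fin N) ℂ))
                      ((Fin.cons t a.1 : TorusSite 4 L), j.succ)) a.2 b.2
                else 0) +
                (if a.1 = Literature.MathematicalPhysics.QuantumFieldTheory.Site.shift b.1 j then
                  unitaryFundamentalRep (Fin N) ℂ
                    (apLift (1 : GaugeConfig 4 L (Matrix.specialUnitaryGroup (Fin N) ℂ))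
                      ((Fin.cons t b.1 : TorusSite 4 L), j.succ))⁻¹ a.2 b.2
                else 0));
      let Bh : ZMod L → Matrix (TorusSite 3 L × Fin N × Fin 4) (TorusSite 3 L × Fin N × Fin 4) ℂ := fun t =>
        Matrix.of fun a b => if a.2.2 = b.2.2 then B t (a.1, a.2.1) (b.1, b.2.1) else 0;
      let M : ZMod L → Matrix (TorusSite 3 L × Fin N × Fin 4) (TorusSite 3 L × Fin N × Fin 4) ℂ := fun t =>
        (1 + Pp * (A t - Bh t) * Pm) * (Bh t * Pp + (Bh t)⁻¹ * Pm) * (1 - Pm * (A t - Bh t) * Pp);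
      let Wt : ZMod L → Matrix (TorusSite 3 L × Fin N × Fin 4) (TorusSite 3 L × Fin N × Fin 4) ℂ := fun t =>
        Matrix.of fun a b => if a.1 = b.1 ∧ a.2.2 = b.2.2 then
          ((1 : GaugeConfig 4 L (Matrix.specialUnitaryGroup (Fin N) ℂ)) ((Fin.cons t a.1 : TorusSite 4 L), 0) :
            Matrix (Fin N) (Fin N) ℂ) a.2.1 b.2.1 else 0;
      0 < ((1 + ((List.range L).map fun i : ℕ => M (i : ZMod L) * Wt (i : ZMod L)).prod).det).re ∧
        ((1 + ((List.range L).map fun i : ℕ => M (i : ZMod L) * Wt (i : ZMod L)).prod).det).im = 0 := by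
  intro N L _ m hm Pp Pm A B Bh M Wt
  -- (1) Lüscher: every one-step matrix of the lifted free field `apLift 1` is positive definite
  have hM : ∀ t : ZMod L, (M t).PosDef :=
    (wilson_det_transfer_form N L (Matrix.unitaryGroup (Fin N) ℂ) (unitaryFundamentalRep (Fin N) ℂ)
      unitaryFundamentalRep_mem_unitaryGroup
      (apLift (1 : GaugeConfig 4 L (Matrix.specialUnitaryGroup (Fin N) ℂ))) m hm).2
  -- (2) the free temporal transporters are trivial
  have hWt : ∀ t : ZMod L, Wt t = 1 := fun t => by
    ext ⟨x, c, α⟩ ⟨y, e, β⟩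
    simp only [Wt, Matrix.of_apply, Pi.one_apply, OneMemClass.coe_one, Matrix.one_apply, Prod.mk.injEq]
    by_cases hx : x = y <;> by_cases hc : c = e <;> by_cases hα : α = β <;> simp [hx, hc, hα]
  -- (3) the slices of the lifted free field all look alike
  have hA : ∀ t : ZMod L, A t = A 0 := fun t => by
    simp only [A, APTraceFreePos.apLift_one_cons_succ]
  have hB : ∀ t : ZMod L, B t = B 0 := fun t => by
    simp only [B, APTraceFreePos.apLift_one_cons_succ]
  have hBh : ∀ t : ZMod L, Bh t = Bh 0 := fun t => by
    simp only [Bh]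
    rw [hB t]
  have hMt : ∀ t : ZMod L, M t = M 0 := fun t => by
    simp only [M]
    rw [hA t, hBh t]
  -- (4) the ordered product collapses to a power of `M 0`
  have hlist : ((List.range L).map fun i : ℕ => M (i : ZMod L) * Wt (i : ZMod L)) =
      (List.range L).map fun _ : ℕ => M 0 :=
    List.map_congr_left fun i _ => by rw [hWt, Matrix.mul_one, hMt]
  rw [hlist, APTraceFreePos.prod_map_range_const]
  -- (5) positivity
  exact APTraceFreePos.det_one_add_pow_pos (hM 0) L

end Summit.QuantumFields.QCD.Cruxes.StableActionBridge.Sketch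

end
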